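/-
Copyright (c) 2026 the pub-hodgecm-mathlib formalisation cell (harness21).  Prover seat hodgecm-mathlib-LH4-p07 (g3), req620 Track A «(D-RAM) FOUR-FRAME» squad
(MS ROAD A, Stage B brick B7 (iv) «CORE-HANGING COUNT», FILE (D2): the EQUILATERAL GLUE count; Stage B lead LH4-p10 (g2)).  2026-09-04.
-/
import Summits.HodgeConjecture.HodgeConjecture.Theorems.F0P3cDyRamDiagonalCoreHangingCount   -- ★ p856098 (C) (this seat): `finsum_stabiliserWeight_orbit_eq`, `isNormalisedLattice_latt_coreHanging`; brings ★ (A), (B), (iv-a), (iv-b-idx), (iv-c), B5 (ii), B7 (iii), Tools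
import Summits.HodgeConjecture.HodgeConjecture.Theorems.F0P3cDyRamDiagonalCoreHangingFoot    -- (D1) (this seat): `ncard_glue_representatives_eq`, `glue_representatives_eq_empty`, `mapGL_latt_coreHanging_eq_iff_kappa`, `v_one_sub_glueUnit`
import HarnessLib

/-!
# Crux `H413`, MS ROAD A, STAGE B brick B7 (iv), FILE (D2): the core-hanging stratum on the EQUILATERAL foot `n₁ = n₂ = n₃ = m < 2ρ` — the GLUE count `q^{2ρ − ⌈(2ρ−m)∕2⌉}`
# (LH4-p10 (g2) MEMO v2 §4 (H); the second summand of the B10 socket `stub_B7_H`)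

Cell `hodgecm-mathlib` (D-0151), FLOOR 0, crux item H413 = `stmt-HodgeConjecture-24833`; lane `--supports stmt-HodgeConjecture-24833 --as helper` (count-neutral).  THEOREMS ONLY
(no `def`, no instance, no notation, no `sorry`, default heartbeats).  Stratum `𝒮_H(ρ)` as in ★ (C).
THE MATHEMATICS.  On the equilateral foot with `ρ ≤ m < 2ρ` (`e := 2ρ − m ∈ [1, ρ]`) a core-hanging lattice is stable iff `|κ + g₀| ≤ |ϖ|^e` ((D1) §2), so the stratum is
`⨆_{g ∈ R, |g + g₀| ≤ |ϖ|^e} 𝒯·latt V_H(1,1,g)` (`R` a complete irredundant system of fixed units mod `𝔭^ρ`, ★ (iv-c) at `t = 0`; ★ (A) gives one orbit per F-rational class of `κ`, disjoint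
since `κ` is a class invariant; every glue representative is admissible because `|1 − g₀| = 1`).  With (D1)'s class count `q^{⌈ρ∕2⌉−⌈e∕2⌉}` (given a fixed `f₀` with `|f₀ + g₀| ≤ |ϖ|^e`)
and ★ (C)'s orbit term `[𝒯:S̃]∕[𝒰:S_F] = ((q−1)q^{ρ−1})((q−1)q^{2ρ−1}) ∕ (((q−1)q^{⌈ρ∕2⌉−1})((q−1)q^{ρ−1}))`: **`Σᶠ w = q^{2ρ−⌈e∕2⌉}`**; and `0` when no such `f₀` exists (★ B0
`exists_fixed_near_glueUnit_iff`: iff `e ≤ m − d + 1`).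
* `pairwise_disjoint_orbits_of`, `v_one_add_eq_one_of_glue`, `coreHangingStratum_eq_iUnion_orbits_glue`, **`finsum_stabiliserWeight_coreHangingStratum_glue`**,
  **`finsum_stabiliserWeight_coreHangingStratum_glue_eq_zero`**.
HONEST LABEL.  Count-neutral; `HC_CM` is proved only modulo the 7 printed citations (2 remaining named inputs: hLiu418 = `stmt-HodgeConjecture-24832`, h413 = `stmt-HodgeConjecture-24833`)
until rung 0 closes.

## References
* [Kottwitz1986BaseChangeUnits] R. Kottwitz, *Base change for unit elements of Hecke algebras*, Compositio Math. 60 (1986), §1 pp. 240–241 (lattice counts via torus orbits).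
* [Rogawski1990] J. D. Rogawski, *Automorphic Representations of Unitary Groups in Three Variables*, Ann. of Math. Stud. 123 (1990), §4.9 Prop. 4.9.1 (a) p. 55.
* [Serre1979] J.-P. Serre, *Local Fields*, GTM 67 (1979), Ch. IV §2 Prop. 6, Ch. I §6 Prop. 18.
-/

set_option autoImplicit false

noncomputable section

namespace Summit.HodgeConjecture.HodgeConjecture.Cruxes.H413.F0P3cDyRamDiagonalCoreHangingGlueCount

open Matrix WithZero
open Literature.NumberTheory.Automorphic Literature.NumberTheory.Automorphic.HermitianLattice
open Literature.NumberTheory.Automorphic.UnitaryLatticeTree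
open Literature.NumberTheory.LocalFields.WildQuadraticDatum
open Summit.HodgeConjecture.HodgeConjecture.Cruxes.H413.F0P3cDyRamDiagonalTorusDefs
open Summit.HodgeConjecture.HodgeConjecture.Cruxes.H413.F0P3cDyRamDiagonalGluedTorusOrbits
open Summit.HodgeConjecture.HodgeConjecture.Cruxes.H413.F0P3cDyRamDiagonalCoreHangingOrbits
open Summit.HodgeConjecture.HodgeConjecture.Cruxes.H413.F0P3cDyRamDiagonalCoreHangingCount
open Summit.HodgeConjecture.HodgeConjecture.Cruxes.H413.F0P3cDyRamDiagonalCoreHangingFoot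
open Summit.HodgeConjecture.HodgeConjecture.Cruxes.H413.F0P3cDyRamDiagonalGluedClassRepresentatives
open Summit.HodgeConjecture.HodgeConjecture.Cruxes.H413.F0P3cDyRamDiagonalGluedStabiliserIndex
open Summit.HodgeConjecture.HodgeConjecture.Cruxes.H413.F0P3cDyRamDiagonalGluedStabiliserIndexFull
open Summit.HodgeConjecture.HodgeConjecture.Cruxes.H413.F0P3cDyRamDiagonalStratumTools
open scoped Valued WithZero Matrix MatrixGroups

variable {K : Type*} [Field K] [Valued K ℤᵐ⁰]

/-! ## §4 The EQUILATERAL GLUE: decomposition and count -/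

/-- **ORBITS OF DISTINCT ADMISSIBLE REPRESENTATIVES ARE DISJOINT** (any sub-system `S ⊆ R` of fixed units with `|1 + g| = 1`; `κ` mod `𝔭^ρ` is a lattice invariant ★ (A)).
[cite: Kottwitz1986BaseChangeUnits, §1 pp. 240–241] -/
theorem pairwise_disjoint_orbits_of {ϖ : K} (hϖ : Valued.v ϖ = exp (-1 : ℤ)) (ρ : ℕ) {R S : Set K} (hSR : S ⊆ R) (hR1 : ∀ g ∈ R, Valued.v g = 1)
    (hS1 : ∀ g ∈ S, Valued.v (1 + g) = 1) (hR3 : ∀ g ∈ R, ∀ g' ∈ R, Valued.v (g - g') ≤ Valued.v ϖ ^ ρ → g = g') :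
    S.PairwiseDisjoint (fun g : K =>
      {M : Submodule 𝒪[K] (Fin 3 → K) | ∃ u ∈ unitTorus K 3, M = mapGL (diagGLUnits u) (latt (!![1, 0, 0; 1, ϖ ^ ρ, 0; 1 * 1 + g, ϖ ^ ρ * 1, ϖ ^ (2 * ρ)] : Matrix (Fin 3) (Fin 3) K))}) := by
  obtain ⟨hϖ0, hϖ1⟩ := ne_zero_and_v_lt_one_of_v_eq_exp hϖ
  have hpρ : ϖ ^ ρ ≠ 0 := pow_ne_zero _ hϖ0
  have hpr : ϖ ^ (2 * ρ) ≠ 0 := pow_ne_zero _ hϖ0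
  intro g hg g' hg' hne
  rw [Function.onFun, Set.disjoint_left]
  rintro M ⟨u, hu, rfl⟩ ⟨u', hu', hM⟩
  apply hne
  obtain ⟨V₀, hV₀⟩ := exists_gl_coe_eq_glued (1 : K) 1 g hpρ hpr
  obtain ⟨V₀', hV₀'⟩ := exists_gl_coe_eq_glued (1 : K) 1 g' hpρ hpr
  obtain ⟨x₁, ζ₁, y₁, hx₁, hζ₁, hy₁, -, hκ₁, h₁⟩ := exists_coreHanging_of_mem_orbit u hu (hR1 _ (hSR hg)) (hS1 _ hg) (ϖ ^ ρ) (ϖ ^ (2 * ρ)) V₀ hV₀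
  obtain ⟨x₂, ζ₂, y₂, hx₂, hζ₂, -, -, hκ₂, h₂⟩ := exists_coreHanging_of_mem_orbit u' hu' (hR1 _ (hSR hg')) (hS1 _ hg') (ϖ ^ ρ) (ϖ ^ (2 * ρ)) V₀' hV₀'
  rw [← hV₀, ← hV₀', h₁, h₂] at hM
  have hk := v_kappa_sub_le_of_latt_coreHanging_eq hϖ0 hϖ1.le ρ hx₁ hζ₁ hy₁ hx₂ hζ₂ hM
  rw [hκ₁, hκ₂] at hk
  exact hR3 _ (hSR hg) _ (hSR hg') hk

/-- On the equilateral foot a glue representative is admissible: `|1 − g₀| = 1` (equilateral) and `|g + g₀| ≤ |ϖ|^e < 1` give `|1 + g| = 1`. [cite: Rogawski1990, §4.9 Prop. 4.9.1 (a) p. 55] -/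
theorem v_one_add_eq_one_of_glue {ϖ : K} (hϖ : Valued.v ϖ = exp (-1 : ℤ)) {α β : K} {m : ℕ}
    (h₂ : Valued.v (α - 1) = Valued.v ϖ ^ m) (h₃ : Valued.v (β - α) = Valued.v ϖ ^ m) {e : ℕ} (he : 1 ≤ e) {g : K}
    (hg : Valued.v (g + (β - 1) / (α - 1)) ≤ Valued.v ϖ ^ e) : Valued.v (1 + g) = 1 := by
  obtain ⟨hϖ0, hϖ1⟩ := ne_zero_and_v_lt_one_of_v_eq_exp hϖ
  have hvϖ : 0 < Valued.v ϖ := (Valuation.pos_iff _).2 hϖ0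
  have h1 : Valued.v (1 - (β - 1) / (α - 1)) = 1 := by
    have h := v_one_sub_glueUnit hϖ h₂ h₃
    rwa [mul_eq_right₀ (pow_ne_zero _ hvϖ.ne')] at h
  rw [show 1 + g = (1 - (β - 1) / (α - 1)) + (g + (β - 1) / (α - 1)) by ring,
    Valuation.map_add_eq_of_lt_left _ (by rw [h1]; exact hg.trans_lt (pow_lt_one₀ zero_le hϖ1 (by omega))), h1]

/-- **THE EQUILATERAL-GLUE DECOMPOSITION OF THE CORE-HANGING STRATUM INTO `𝒯`-ORBITS**: on `n₁ = n₂ = n₃ = m` with `ρ ≤ m < 2ρ` (`e = 2ρ − m`),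
`𝒮_H(ρ) = ⋃_{g ∈ R, |g + g₀| ≤ |ϖ|^e} 𝒯·latt V_H(1,1,g)` (`g₀ = (β−1)∕(α−1)`; ★ (A) + §2). [cite: Kottwitz1986BaseChangeUnits, §1 pp. 240–241] [cite: Rogawski1990, §4.9 Prop. 4.9.1 (a) p. 55] -/
theorem coreHangingStratum_eq_iUnion_orbits_glue {σ : K →+* K} (hσ : ∀ a, σ (σ a) = a) (hvσ : ∀ a, Valued.v (σ a) = Valued.v a)
    {ϖ : K} (hϖ : Valued.v ϖ = exp (-1 : ℤ)) (hTr : ∀ a : K, Valued.v (a + σ a) ≤ Valued.v ϖ * Valued.v a)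
    (T : GL (Fin 3) K) {α β : K} (hT : (T : Matrix (Fin 3) (Fin 3) K) = Matrix.diagonal ![α, β, 1]) (hα : Valued.v α = 1) (hβ : Valued.v β = 1)
    {m : ℕ} (h₁ : Valued.v (β - 1) = Valued.v ϖ ^ m) (h₂ : Valued.v (α - 1) = Valued.v ϖ ^ m) (h₃ : Valued.v (β - α) = Valued.v ϖ ^ m)
    {ρ : ℕ} (hρ : 1 ≤ ρ) (hρm : ρ ≤ m) (hm : m < 2 * ρ)
    {R : Set K} (hR1 : ∀ g ∈ R, σ g = g ∧ Valued.v g = 1) (hR2 : ∀ f : K, σ f = f → Valued.v f = 1 → ∃ g ∈ R, Valued.v (f - g) ≤ Valued.v ϖ ^ ρ) :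
    {M : Submodule 𝒪[K] (Fin 3 → K) | M ∈ normalisedStableLattices T ∧ IsDualisableLattice σ ϖ M ∧
        ∃ x ζ y'' : K, Valued.v x = 1 ∧ Valued.v ζ = 1 ∧ Valued.v y'' = 1 ∧ Valued.v (x * ζ + y'') = 1 ∧
          M = latt (!![1, 0, 0; x, ϖ ^ ρ, 0; x * ζ + y'', ϖ ^ ρ * ζ, ϖ ^ (2 * ρ)] : Matrix (Fin 3) (Fin 3) K)} =
      ⋃ g ∈ {g : K | g ∈ R ∧ Valued.v (g + (β - 1) / (α - 1)) ≤ Valued.v ϖ ^ (2 * ρ - m)},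
        {M | ∃ u ∈ unitTorus K 3, M = mapGL (diagGLUnits u) (latt (!![1, 0, 0; 1, ϖ ^ ρ, 0; 1 * 1 + g, ϖ ^ ρ * 1, ϖ ^ (2 * ρ)] : Matrix (Fin 3) (Fin 3) K))} := by
  obtain ⟨hϖ0, hϖ1⟩ := ne_zero_and_v_lt_one_of_v_eq_exp hϖ
  have hpρ : ϖ ^ ρ ≠ 0 := pow_ne_zero _ hϖ0
  have hpr : ϖ ^ (2 * ρ) ≠ 0 := pow_ne_zero _ hϖ0
  have he1 : 1 ≤ 2 * ρ - m := by omega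
  have hρe : Valued.v ϖ ^ ρ ≤ Valued.v ϖ ^ (2 * ρ - m) := by rw [v_varpi_pow hϖ, v_varpi_pow hϖ, exp_le_exp]; omega
  ext M
  simp only [Set.mem_setOf_eq, Set.mem_iUnion, exists_prop]
  constructor
  · rintro ⟨⟨-, hTM, -⟩, hdual, x, ζ, y'', hx, hζ, hy'', hy, rfl⟩
    obtain ⟨V, hV⟩ := exists_gl_coe_eq_glued x ζ y'' hpρ hpr
    rw [← hV] at hdual hTM
    obtain ⟨-, -, hS3⟩ := (mapGL_latt_coreHanging_eq_iff_kappa hϖ hα hβ T hT h₁ h₂ h₃ ρ hx hζ hy'' V hV).1 hTM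
    obtain ⟨f, hσf, hκf⟩ := (isDualisableLattice_latt_coreHanging_iff_exists_fixed_kappa hσ hvσ hϖ0 hϖ1 hTr ρ hρ hx hζ hy'' hy V hV).1 hdual
    obtain ⟨hvf, -⟩ := fixed_kappa_unit_letters hϖ1 hρ hx hζ hy'' hy hκf
    obtain ⟨g, hgR, hfg⟩ := hR2 f hσf hvf
    have hκg : Valued.v (y'' / (x * ζ) - g) ≤ Valued.v ϖ ^ ρ := by
      have e : y'' / (x * ζ) - g = (y'' / (x * ζ) - f) + (f - g) := by ring
      rw [e]; exact Valuation.map_add_le _ hκf hfg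
    have hge : Valued.v (g + (β - 1) / (α - 1)) ≤ Valued.v ϖ ^ (2 * ρ - m) := by
      rw [show g + (β - 1) / (α - 1) = (y'' / (x * ζ) + (β - 1) / (α - 1)) - (y'' / (x * ζ) - g) by ring]
      exact Valuation.map_sub_le _ hS3 (hκg.trans hρe)
    have h1g : Valued.v (1 + g) = 1 :=
      v_one_add_eq_one_of_near (v_one_add_kappa_eq_one hx hζ hy) (hκg.trans_lt (v_pow_lt_one hϖ1 hρ))
    obtain ⟨V₀, hV₀⟩ := exists_gl_coe_eq_glued (1 : K) 1 g hpρ hpr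
    obtain ⟨u, hu, hM⟩ := exists_mem_unitTorus_latt_coreHanging_eq_mapGL hϖ0 ρ hx hζ hy h1g hκg V₀ hV₀
    exact ⟨g, ⟨hgR, hge⟩, u, hu, by rw [hM, hV₀]⟩
  · rintro ⟨g, ⟨hgR, hge⟩, u, hu, rfl⟩
    obtain ⟨hσg, hvg⟩ := hR1 g hgR
    have h1g : Valued.v (1 + g) = 1 := v_one_add_eq_one_of_glue hϖ h₂ h₃ he1 hge
    obtain ⟨V₀, hV₀⟩ := exists_gl_coe_eq_glued (1 : K) 1 g hpρ hpr
    obtain ⟨x', ζ', y₁, hx', hζ', hy₁, hy', hκ, hM⟩ := exists_coreHanging_of_mem_orbit u hu hvg h1g (ϖ ^ ρ) (ϖ ^ (2 * ρ)) V₀ hV₀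
    rw [← hV₀, hM]
    obtain ⟨V, hV⟩ := exists_gl_coe_eq_glued x' ζ' y₁ hpρ hpr
    refine ⟨⟨⟨V, by rw [hV]⟩, ?_, isNormalisedLattice_latt_coreHanging hϖ1.le ρ hx' hζ' hy'⟩, ?_, x', ζ', y₁, hx', hζ', hy₁, hy', rfl⟩
    · rw [← hV]
      exact (mapGL_latt_coreHanging_eq_iff_kappa hϖ hα hβ T hT h₁ h₂ h₃ ρ hx' hζ' hy₁ V hV).2 ⟨hρm, hρm, by rw [hκ]; exact hge⟩
    · rw [← hV]
      exact (isDualisableLattice_latt_coreHanging_iff_exists_fixed_kappa hσ hvσ hϖ0 hϖ1 hTr ρ hρ hx' hζ' hy₁ hy' V hV).2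
        ⟨g, hσg, by rw [hκ, sub_self, map_zero]; exact zero_le⟩

/-- **B7 (iv), EQUILATERAL GLUE — THE WEIGHTED COUNT IS `q^{2ρ − ⌈(2ρ−m)∕2⌉}`.**  Datum letters with the wild trace bound, finite residue field (`q = #𝓀`), `T = diag(α, β, 1)` with
unit entries on the EQUILATERAL foot `|β−1| = |α−1| = |β−α| = |ϖ|^m`, `1 ≤ ρ ≤ m < 2ρ`, and a FIXED `f₀` with `|f₀ + (β−1)∕(α−1)| ≤ |ϖ|^{2ρ−m}` (the glue unit is `F`-rational to depth
`2ρ − m`; ★ B0 `exists_fixed_near_glueUnit_iff` ⟺ `2ρ − m ≤ m − d + 1`):  `∑ᶠ_{M ∈ 𝒮_H(ρ)} w(M) = q^{2ρ − (2ρ−m+1)∕2}` (MEMO v2 §4 (H); the glue summand of `stub_B7_H`).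
[cite: Rogawski1990, §4.9 Prop. 4.9.1 (a) p. 55] [cite: Kottwitz1986BaseChangeUnits, §1 pp. 240–241] -/
theorem finsum_stabiliserWeight_coreHangingStratum_glue {σ : K →+* K} (hσ : ∀ a, σ (σ a) = a) (hvσ : ∀ a, Valued.v (σ a) = Valued.v a)
    (hfix : ∀ x : K, σ x = x → x ≠ 0 → ∃ n : ℤ, Valued.v x = exp (2 * n)) {ϖ : K} (hϖ : Valued.v ϖ = exp (-1 : ℤ))
    {d : ℕ} (hd : Valued.v (ϖ - σ ϖ) = Valued.v ϖ ^ d) (hTr : ∀ a : K, Valued.v (a + σ a) ≤ Valued.v ϖ * Valued.v a) [Finite 𝓀[K]]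
    (T : GL (Fin 3) K) {α β : K} (hT : (T : Matrix (Fin 3) (Fin 3) K) = Matrix.diagonal ![α, β, 1]) (hα : Valued.v α = 1) (hβ : Valued.v β = 1)
    {m : ℕ} (h₁ : Valued.v (β - 1) = Valued.v ϖ ^ m) (h₂ : Valued.v (α - 1) = Valued.v ϖ ^ m) (h₃ : Valued.v (β - α) = Valued.v ϖ ^ m)
    {ρ : ℕ} (hρ : 1 ≤ ρ) (hρm : ρ ≤ m) (hm : m < 2 * ρ)
    {f₀ : K} (hσf₀ : σ f₀ = f₀) (hf₀ : Valued.v (f₀ + (β - 1) / (α - 1)) ≤ Valued.v ϖ ^ (2 * ρ - m)) :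
    ∑ᶠ M ∈ {M : Submodule 𝒪[K] (Fin 3 → K) | M ∈ normalisedStableLattices T ∧ IsDualisableLattice σ ϖ M ∧
        ∃ x ζ y'' : K, Valued.v x = 1 ∧ Valued.v ζ = 1 ∧ Valued.v y'' = 1 ∧ Valued.v (x * ζ + y'') = 1 ∧
          M = latt (!![1, 0, 0; x, ϖ ^ ρ, 0; x * ζ + y'', ϖ ^ ρ * ζ, ϖ ^ (2 * ρ)] : Matrix (Fin 3) (Fin 3) K)}, stabiliserWeight σ M =
      (Nat.card 𝓀[K] : ℚ) ^ (2 * ρ - (2 * ρ - m + 1) / 2) := by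
  obtain ⟨hϖ0, hϖ1⟩ := ne_zero_and_v_lt_one_of_v_eq_exp hϖ
  have hvϖ : 0 < Valued.v ϖ := (Valuation.pos_iff _).2 hϖ0
  have hq : 1 < Nat.card 𝓀[K] := Finite.one_lt_card
  have he1 : 1 ≤ 2 * ρ - m := by omega
  have heρ : 2 * ρ - m ≤ ρ := by omega
  -- `|g₀| = 1`
  have hα1 : α - 1 ≠ 0 := fun h0 => by rw [h0, map_zero] at h₂; exact pow_ne_zero _ hvϖ.ne' h₂.symm
  have hg₀ : Valued.v ((β - 1) / (α - 1)) = 1 := by rw [map_div₀, h₁, h₂, div_self (pow_ne_zero _ hvϖ.ne')]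
  -- representatives (★ (iv-c) at `t = 0`) and the glue ones (§1)
  obtain ⟨R, hRfin, -, hR1, hR2, hR3⟩ := exists_fixed_class_representatives hσ hvσ hfix hϖ hd ρ 0 hρ
  simp only [Nat.mul_zero, pow_zero, Nat.add_zero] at hR1 hR2 hR3
  have hglue := ncard_glue_representatives_eq hσ hvσ hfix hϖ hd he1 heρ hRfin hR1 hR2 hR3 hg₀ hσf₀ hf₀
  have hRgfin : {g : K | g ∈ R ∧ Valued.v (g + (β - 1) / (α - 1)) ≤ Valued.v ϖ ^ (2 * ρ - m)}.Finite := hRfin.subset (Set.sep_subset _ _)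
  rw [coreHangingStratum_eq_iUnion_orbits_glue hσ hvσ hϖ hTr T hT hα hβ h₁ h₂ h₃ hρ hρm hm hR1 hR2,
    finsum_mem_biUnion (pairwise_disjoint_orbits_of hϖ ρ (Set.sep_subset _ _) (fun g hg => (hR1 g hg).2)
      (fun g hg => v_one_add_eq_one_of_glue hϖ h₂ h₃ he1 hg.2) hR3) hRgfin ?_]
  · rw [finsum_mem_eq_ncard_mul hRgfin _ _ (fun g hg => finsum_stabiliserWeight_orbit_eq hσ hvσ hfix hϖ hd hρ (hR1 _ hg.1).1 (hR1 _ hg.1).2), hglue]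
    -- arithmetic: `q^{a−b}·((q−1)q^{ρ−1})((q−1)q^{2ρ−1}) ∕ (((q−1)q^{a−1})((q−1)q^{ρ−1})) = q^{2ρ−b}`, `a = ⌈ρ∕2⌉`, `b = ⌈e∕2⌉`
    have hq1 : ((Nat.card 𝓀[K] : ℚ) - 1) ≠ 0 := by
      have : (1 : ℚ) < Nat.card 𝓀[K] := by exact_mod_cast hq
      linarith
    have hq0 : (Nat.card 𝓀[K] : ℚ) ≠ 0 := by exact_mod_cast (by omega : Nat.card 𝓀[K] ≠ 0)
    have hden : ((((Nat.card 𝓀[K] - 1) * Nat.card 𝓀[K] ^ ((ρ + 1) / 2 - 1)) * ((Nat.card 𝓀[K] - 1) * Nat.card 𝓀[K] ^ (ρ - 1)) : ℕ) : ℚ) ≠ 0 := by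
      push_cast [Nat.cast_sub hq.le]
      exact mul_ne_zero (mul_ne_zero hq1 (pow_ne_zero _ hq0)) (mul_ne_zero hq1 (pow_ne_zero _ hq0))
    rw [← mul_assoc, mul_inv_eq_iff_eq_mul₀ hden]
    have key : (Nat.card 𝓀[K] : ℚ) ^ ((ρ + 1) / 2 - (2 * ρ - m + 1) / 2) * (Nat.card 𝓀[K] : ℚ) ^ (ρ - 1) * (Nat.card 𝓀[K] : ℚ) ^ (2 * ρ - 1) =
        (Nat.card 𝓀[K] : ℚ) ^ (2 * ρ - (2 * ρ - m + 1) / 2) * (Nat.card 𝓀[K] : ℚ) ^ ((ρ + 1) / 2 - 1) * (Nat.card 𝓀[K] : ℚ) ^ (ρ - 1) := by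
      rw [← pow_add, ← pow_add, ← pow_add, ← pow_add]
      congr 1
      omega
    push_cast [Nat.cast_sub hq.le]
    linear_combination ((Nat.card 𝓀[K] : ℚ) - 1) ^ 2 * key
  · intro g hg
    obtain ⟨V₀, hV₀⟩ := exists_gl_coe_eq_glued (1 : K) 1 g (pow_ne_zero ρ hϖ0) (pow_ne_zero (2 * ρ) hϖ0)
    have hV0 : (V₀ : Matrix (Fin 3) (Fin 3) K) = !![1, 0, 0; 1, ϖ ^ ρ, 0; 1 * 1 + g, ϖ ^ ρ * 1, ϖ ^ (2 * ρ + 0)] := by rw [Nat.add_zero]; exact hV₀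
    have hcard := ncard_unitTorus_orbit_latt_glued_eq hϖ hρ 0 (map_one _) (map_one _) (by rw [pow_zero]; exact (hR1 _ hg.1).2) V₀ hV0
    rw [← hV₀]
    refine Set.finite_of_ncard_ne_zero ?_
    rw [hcard]
    exact mul_ne_zero (mul_ne_zero (by omega) (pow_ne_zero _ (by omega))) (mul_ne_zero (by omega) (pow_ne_zero _ (by omega)))

/-- **B7 (iv), EQUILATERAL foot, glue unit NOT `F`-rational to depth `2ρ − m`: the weighted count is `0`** (no orbit qualifies). [cite: Kottwitz1986BaseChangeUnits, §1 pp. 240–241] -/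
theorem finsum_stabiliserWeight_coreHangingStratum_glue_eq_zero {σ : K →+* K} (hσ : ∀ a, σ (σ a) = a) (hvσ : ∀ a, Valued.v (σ a) = Valued.v a)
    (hfix : ∀ x : K, σ x = x → x ≠ 0 → ∃ n : ℤ, Valued.v x = exp (2 * n)) {ϖ : K} (hϖ : Valued.v ϖ = exp (-1 : ℤ))
    {d : ℕ} (hd : Valued.v (ϖ - σ ϖ) = Valued.v ϖ ^ d) (hTr : ∀ a : K, Valued.v (a + σ a) ≤ Valued.v ϖ * Valued.v a) [Finite 𝓀[K]]
    (T : GL (Fin 3) K) {α β : K} (hT : (T : Matrix (Fin 3) (Fin 3) K) = Matrix.diagonal ![α, β, 1]) (hα : Valued.v α = 1) (hβ : Valued.v β = 1)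
    {m : ℕ} (h₁ : Valued.v (β - 1) = Valued.v ϖ ^ m) (h₂ : Valued.v (α - 1) = Valued.v ϖ ^ m) (h₃ : Valued.v (β - α) = Valued.v ϖ ^ m)
    {ρ : ℕ} (hρ : 1 ≤ ρ) (hρm : ρ ≤ m) (hm : m < 2 * ρ)
    (hno : ¬ ∃ f : K, σ f = f ∧ Valued.v (f + (β - 1) / (α - 1)) ≤ Valued.v ϖ ^ (2 * ρ - m)) :
    ∑ᶠ M ∈ {M : Submodule 𝒪[K] (Fin 3 → K) | M ∈ normalisedStableLattices T ∧ IsDualisableLattice σ ϖ M ∧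
        ∃ x ζ y'' : K, Valued.v x = 1 ∧ Valued.v ζ = 1 ∧ Valued.v y'' = 1 ∧ Valued.v (x * ζ + y'') = 1 ∧
          M = latt (!![1, 0, 0; x, ϖ ^ ρ, 0; x * ζ + y'', ϖ ^ ρ * ζ, ϖ ^ (2 * ρ)] : Matrix (Fin 3) (Fin 3) K)}, stabiliserWeight σ M = 0 := by
  obtain ⟨R, -, -, hR1, hR2, -⟩ := exists_fixed_class_representatives hσ hvσ hfix hϖ hd ρ 0 hρ
  simp only [Nat.mul_zero, pow_zero, Nat.add_zero] at hR1 hR2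
  rw [coreHangingStratum_eq_iUnion_orbits_glue hσ hvσ hϖ hTr T hT hα hβ h₁ h₂ h₃ hρ hρm hm hR1 hR2,
    show {g : K | g ∈ R ∧ Valued.v (g + (β - 1) / (α - 1)) ≤ Valued.v ϖ ^ (2 * ρ - m)} = ∅ from glue_representatives_eq_empty hR1 hno]
  simp

end Summit.HodgeConjecture.HodgeConjecture.Cruxes.H413.F0P3cDyRamDiagonalCoreHangingGlueCount

end
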